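import Literature.Geometry.GaugeTheory.AsdFrameIndependence
import Mathlib.Analysis.Calculus.FDeriv.Symmetric
import Mathlib.Analysis.Calculus.ContDiff.Operations
import Mathlib.Analysis.InnerProductSpace.Calculus
import Mathlib.Analysis.Normed.Module.Alternating.Basic
import Mathlib.Geometry.Manifold.MFDeriv.FDeriv
import HarnessLib

/-!
# The two-patch model of `P_k` over flat `ℝ⁴`: calculus of the local connection forms and
# gauge covariance of the curvature on the overlap

Topic `Literature/Geometry/GaugeTheory`; companion *proofs* file (theorems only: no definition, no
named fact) of `AsdModuliSpace.lean`, specialised to the base `X = ℝ⁴ = EuclideanSpace ℝ (Fin 4)`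
modelled on itself (all charts are the identity). There the chart-wise notions of that file become
ordinary multivariable calculus, which we record:

* `QuatOneForm.smoothAt_iff_contDiffAt` — a local connection form `B : x ↦ (T_xℝ⁴ →L ℍ)` is
  smooth at `x` in the sense of `QuatOneForm.SmoothAt` iff it is `C^∞` at `x` as a map
  `ℝ⁴ → (ℝ⁴ →L[ℝ] ℍ)`;
* `QuatOneForm.extDeriv_eq_fderiv` — `dB(x)(u, v) = ∂_u (B·v)(x) - ∂_v (B·u)(x)` (the tree's
  `mextDeriv`, i.e. Mathlib's `extDeriv`, in Mathlib's normalisation);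
* `quatDeriv_eq_fderiv`, `patch_one_eq_univ`, `clutchingFun_apply_flat`,
  `contDiffAt_clutchingFun` — the clutching function `γ = (q/‖q‖)^k` of `P_k` is `C^∞` off the
  base point;
* **gauge covariance of the curvature on the overlap**
  (`SpOneConnection.clutchingFun_mul_curvature_one`, `SpOneConnection.curvature_one_eq_conj`):
  for every connection `A` on `P_k` (gluing law `A₁ = γ⁻¹ A₀ γ + γ⁻¹ dγ` on `ℝ⁴ ∖ {p}`),
  `F₁ = γ⁻¹ F₀ γ` on `ℝ⁴ ∖ {p}` — the classical transformation law of `F = dA + A ∧ A` under a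
  change of trivialisation (Labastida–Mariño 2005, §2.1, after (2.3)–(2.4); Donaldson–Kronheimer
  1990, §2.1; Naber 1997, §5.1), proved here by differentiating the gluing law
  `γ A₁ = A₀ γ + dγ` and using the symmetry of the second derivative of `γ`;
* consequences: the curvature density and the anti-self-duality condition may be read through
  either patch (`SpOneConnection.twoFormNormSq_curvature_one`,
  `SpOneConnection.curvatureDensity_eq_twoFormNormSq`, `SpOneConnection.isASDIn_curvature_one_iff`,
  `SpOneConnection.isASD_iff_patch_one`): over flat `ℝ⁴` a connection on `P_k` is anti-self-dual
  iff its ball-patch form `A₁` (defined on all of `ℝ⁴`) has `F₁⁺ = 0` everywhere.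

This is the setting of the local model of a concentrated instanton (the standard instanton on
`ℝ⁴`, vendored separately) and of every chart computation with the objects of `AsdModuliSpace.lean`.

## References

* J. Labastida, M. Mariño, *Topological Quantum Field Theory and Four Manifolds* (2005), §2.1,
  (2.1)–(2.4). [LabastidaMarino2005]
* S. K. Donaldson, P. B. Kronheimer, *The Geometry of Four-Manifolds* (1990), §2.1.
  [DonaldsonKronheimer1990]
* G. L. Naber, *Topology, Geometry, and Gauge Fields* (1997), §§3.4, 5.1. [Naber1997]
-/

noncomputable section

open scoped Manifold ContDiff Topology Quaternion
open Set Function Filter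
open Literature.Geometry.Lorentzian (PseudoRiemannianMetric)
open Literature.Topology.FourManifolds (SmoothOrientation)

namespace Literature.Geometry.GaugeTheory

/-! ### The model space: charts are the identity -/

/-- Over the model space the ball patch of the base point is everything: the preferred chart at
`p` is the identity of `ℝ⁴`. [folklore] -/
theorem patch_one_eq_univ (p : EuclideanSpace ℝ (Fin 4)) : patch p 1 = univ := by
  rw [patch_one, extChartAt_model_space_eq_id, PartialEquiv.refl_source]

/-- The punctured patch is the complement of the base point. [folklore] -/
theorem mem_patch_zero_iff {p x : EuclideanSpace ℝ (Fin 4)} : x ∈ patch p 0 ↔ x ≠ p := by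
  simp

/-- On the model space the differential `quatDeriv u x` of an `ℍ`-valued function (Mathlib's
`mfderiv`) is the Fréchet derivative `fderiv ℝ u x`. [folklore] -/
theorem quatDeriv_eq_fderiv (u : EuclideanSpace ℝ (Fin 4) → ℍ) (x : EuclideanSpace ℝ (Fin 4)) :
    quatDeriv u x = fderiv ℝ u x :=
  mfderiv_eq_fderiv

/-! ### Local connection forms on the model space -/

namespace QuatOneForm

variable (B : QuatOneForm (EuclideanSpace ℝ (Fin 4)))

/-- The degree-one `MForm` of a 1-form is the 1-form followed by the linear isometry
`(ℝ⁴ →L ℍ) ≃ₗᵢ (ℝ⁴ [⋀^Fin 1]→L ℍ)`. [folklore] -/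
theorem toMForm_eq_comp :
    B.toMForm = ⇑(ContinuousAlternatingMap.ofSubsingletonLIE (𝕜 := ℝ)
      (E := EuclideanSpace ℝ (Fin 4)) (F := ℍ) (0 : Fin 1)) ∘
      (B : EuclideanSpace ℝ (Fin 4) → EuclideanSpace ℝ (Fin 4) →L[ℝ] ℍ) :=
  rfl

/-- On the model space the chart representative of the `MForm` of a 1-form is that `MForm` (the
charts are the identity). [folklore] -/
theorem inChart_toMForm (x : EuclideanSpace ℝ (Fin 4)) : B.toMForm.inChart x = B.toMForm := by
  funext y
  ext1 v
  simp only [Literature.Geometry.Kaehler.MForm.inChart_apply, ModelWithCorners.range_eq_univ,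
    mfderivWithin_univ, mfderiv_eq_fderiv, extChartAt_model_space_eq_id, PartialEquiv.refl_symm,
    PartialEquiv.refl_coe, fderiv_id]
  rfl

/-- **Smoothness of a local connection form over flat `ℝ⁴` is ordinary smoothness**: the
chart-wise `QuatOneForm.SmoothAt B x` holds iff `y ↦ B(y) ∈ (ℝ⁴ →L[ℝ] ℍ)` is `C^∞` at `x`.
[folklore] -/
theorem smoothAt_iff_contDiffAt {x : EuclideanSpace ℝ (Fin 4)} :
    B.SmoothAt x ↔ ContDiffAt (F := EuclideanSpace ℝ (Fin 4) →L[ℝ] ℍ) ℝ ∞ B x := by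
  unfold QuatOneForm.SmoothAt
  rw [inChart_toMForm, ModelWithCorners.range_eq_univ, contDiffWithinAt_univ,
    extChartAt_model_space_eq_id, PartialEquiv.refl_coe, id_eq, toMForm_eq_comp]
  exact (ContinuousAlternatingMap.ofSubsingletonLIE (𝕜 := ℝ) (E := EuclideanSpace ℝ (Fin 4))
    (F := ℍ) (0 : Fin 1)).toContinuousLinearEquiv.comp_contDiffAt_iff

/-- Differentiability of the `MForm` of a 1-form is differentiability of the 1-form. [folklore] -/
theorem differentiableAt_toMForm_iff {x : EuclideanSpace ℝ (Fin 4)} :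
    DifferentiableAt (F := EuclideanSpace ℝ (Fin 4) [⋀^Fin 1]→L[ℝ] ℍ) ℝ B.toMForm x ↔
      DifferentiableAt (F := EuclideanSpace ℝ (Fin 4) →L[ℝ] ℍ) ℝ B x := by
  rw [toMForm_eq_comp]
  exact (ContinuousAlternatingMap.ofSubsingletonLIE (𝕜 := ℝ) (E := EuclideanSpace ℝ (Fin 4))
    (F := ℍ) (0 : Fin 1)).toContinuousLinearEquiv.comp_differentiableAt_iff

/-- **The exterior derivative of a 1-form over flat `ℝ⁴`**: if `B` is differentiable at `x`,
`dB(x)(u, v) = ∂_u (B·v)(x) - ∂_v (B·u)(x)`, where `∂_u (B·v)(x)` is the derivative at `x` in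
the direction `u` of the `ℍ`-valued function `y ↦ B(y)(v)` (the tree's `QuatOneForm.extDeriv`
is Mathlib's `extDeriv` on the model space, `mextDeriv_eq_extDeriv`, in the normalisation of
`extDeriv_apply`). [folklore] -/
theorem extDeriv_eq_fderiv {x : EuclideanSpace ℝ (Fin 4)}
    (hB : DifferentiableAt (F := EuclideanSpace ℝ (Fin 4) →L[ℝ] ℍ) ℝ B x)
    (u v : EuclideanSpace ℝ (Fin 4)) :
    B.extDeriv x u v = fderiv ℝ (fun y ↦ B y v) x u - fderiv ℝ (fun y ↦ B y u) x v := by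
  have hB' : DifferentiableAt (F := EuclideanSpace ℝ (Fin 4) [⋀^Fin 1]→L[ℝ] ℍ) ℝ B.toMForm x :=
    (differentiableAt_toMForm_iff B).2 hB
  unfold QuatOneForm.extDeriv
  rw [Literature.Geometry.Kaehler.mextDeriv_eq_extDeriv]
  show _root_.extDeriv (E := EuclideanSpace ℝ (Fin 4)) (F := ℍ) (n := 1) B.toMForm x ![u, v] = _
  rw [extDeriv_apply hB', Fin.sum_univ_two]
  simp only [Fin.isValue, Fin.val_zero, pow_zero, one_smul, Fin.val_one, pow_one, neg_smul,
    Matrix.cons_val_zero, Matrix.cons_val_one, Matrix.cons_val_fin_one]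
  rw [sub_eq_add_neg]
  rfl

end QuatOneForm

/-! ### The clutching function over flat `ℝ⁴` -/

section Clutching

variable (o : SmoothOrientation (𝓡 4) (EuclideanSpace ℝ (Fin 4)))

/-- The oriented quaternionic coordinate is additive. [folklore] -/
theorem orientedQuat_add (p : EuclideanSpace ℝ (Fin 4)) (v w : EuclideanSpace ℝ (Fin 4)) :
    orientedQuat o p (v + w) = orientedQuat o p v + orientedQuat o p w := by
  unfold orientedQuat
  split_ifs <;> simp [map_add, star_add]

/-- The oriented quaternionic coordinate is homogeneous. [folklore] -/
theorem orientedQuat_smul (p : EuclideanSpace ℝ (Fin 4)) (c : ℝ) (v : EuclideanSpace ℝ (Fin 4)) :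
    orientedQuat o p (c • v) = c • orientedQuat o p v := by
  unfold orientedQuat
  split_ifs <;> simp [Quaternion.star_smul]

/-- The oriented quaternionic coordinate is `C^∞` (it is `ℝ`-linear). [folklore] -/
theorem contDiff_orientedQuat (p : EuclideanSpace ℝ (Fin 4)) : ContDiff ℝ ∞ (orientedQuat o p) := by
  have hlin : IsLinearMap ℝ (orientedQuat o p) := ⟨orientedQuat_add o p, orientedQuat_smul o p⟩
  exact (LinearMap.toContinuousLinearMap (hlin.mk' _)).contDiff

/-- Over flat `ℝ⁴` the clutching function is `γ(y) = (q/‖q‖)^k` with `q = orientedQuat o p (y - p)`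
(the preferred chart at `p` is the identity). [cite: Naber1997, §3.4] -/
theorem clutchingFun_apply_flat (k : ℤ) (p y : EuclideanSpace ℝ (Fin 4)) :
    clutchingFun o k p y =
      ((‖orientedQuat o p (y - p)‖⁻¹ : ℝ) • orientedQuat o p (y - p)) ^ k := by
  simp only [clutchingFun, extChartAt_model_space_eq_id, PartialEquiv.refl_coe, id_eq]

/-- **The clutching function is smooth off the base point** (over flat `ℝ⁴`): `y ↦ (q/‖q‖)^k`,
`q = q(y - p)`, is `C^∞` at every `y ≠ p` (a smooth unit-quaternion-valued map on `ℝ⁴ ∖ {p}`;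
negative powers through the inverse, smooth on `ℍ ∖ {0}`). [cite: Naber1997, §3.4] -/
theorem contDiffAt_clutchingFun (k : ℤ) {p y : EuclideanSpace ℝ (Fin 4)} (hy : y ≠ p) :
    ContDiffAt ℝ ∞ (clutchingFun o k p) y := by
  have hfun : clutchingFun o k p = fun y ↦
      ((‖orientedQuat o p (y - p)‖⁻¹ : ℝ) • orientedQuat o p (y - p)) ^ k :=
    funext (clutchingFun_apply_flat o k p)
  rw [hfun]
  set q : EuclideanSpace ℝ (Fin 4) → ℍ := fun y ↦ orientedQuat o p (y - p) with hq
  have hqs : ContDiff ℝ ∞ q := (contDiff_orientedQuat o p).comp (contDiff_id.sub contDiff_const)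
  have hq0 : q y ≠ 0 := by
    rw [hq, Ne, orientedQuat_eq_zero_iff, sub_eq_zero]
    exact hy
  have hn : ContDiffAt ℝ ∞ (fun y ↦ ‖q y‖⁻¹) y :=
    ((contDiffAt_norm ℝ hq0).comp y hqs.contDiffAt).inv (norm_ne_zero_iff.2 hq0)
  have hu : ContDiffAt ℝ ∞ (fun y ↦ (‖q y‖⁻¹ : ℝ) • q y) y := hn.smul hqs.contDiffAt
  have hu0 : (‖q y‖⁻¹ : ℝ) • q y ≠ 0 := smul_ne_zero (inv_ne_zero (norm_ne_zero_iff.2 hq0)) hq0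
  show ContDiffAt ℝ ∞ (fun y ↦ ((‖q y‖⁻¹ : ℝ) • q y) ^ k) y
  rcases Int.eq_nat_or_neg k with ⟨n, rfl | rfl⟩
  · simp_rw [zpow_natCast]
    exact hu.pow n
  · simp_rw [zpow_neg, zpow_natCast]
    have hp0 : ((‖q y‖⁻¹ : ℝ) • q y) ^ n ≠ 0 := pow_ne_zero n hu0
    have hinv : ContDiffAt ℝ ∞ (Inv.inv : ℍ → ℍ) (((‖q y‖⁻¹ : ℝ) • q y) ^ n) := by
      rw [← Ring.inverse_eq_inv']
      exact contDiffAt_ringInverse (𝕜 := ℝ) (Units.mk0 _ hp0)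
    exact hinv.comp y (hu.pow n)

end Clutching

/-! ### Gauge covariance of the curvature on the overlap -/

namespace SpOneConnection

variable {o : SmoothOrientation (𝓡 4) (EuclideanSpace ℝ (Fin 4))} {k : ℤ}
  {p : EuclideanSpace ℝ (Fin 4)}

/-- Over flat `ℝ⁴` the punctured-patch form `A₀` is `C^∞` off the base point. [folklore] -/
theorem contDiffAt_form_zero (A : SpOneConnection o k p) {y : EuclideanSpace ℝ (Fin 4)}
    (hy : y ≠ p) : ContDiffAt (F := EuclideanSpace ℝ (Fin 4) →L[ℝ] ℍ) ℝ ∞ (A.form 0) y :=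
  (A.form 0).smoothAt_iff_contDiffAt.1 (A.smoothAt 0 y (mem_patch_zero_iff.2 hy))

/-- Over flat `ℝ⁴` the ball-patch form `A₁` is `C^∞` everywhere. [folklore] -/
theorem contDiffAt_form_one (A : SpOneConnection o k p) (y : EuclideanSpace ℝ (Fin 4)) :
    ContDiffAt (F := EuclideanSpace ℝ (Fin 4) →L[ℝ] ℍ) ℝ ∞ (A.form 1) y :=
  (A.form 1).smoothAt_iff_contDiffAt.1 (A.smoothAt 1 y (by rw [patch_one_eq_univ]; exact mem_univ y))

/-- **The gluing law, multiplicative form**: `γ A₁(w) = A₀(w) γ + dγ(w)` off the base point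
(`A₁ = γ⁻¹ A₀ γ + γ⁻¹ dγ` multiplied by `γ ≠ 0` on the left; Labastida–Mariño 2005, (2.1), (2.4)).
[cite: LabastidaMarino2005, §2.1 (2.1)] -/
theorem clutchingFun_mul_form_one (A : SpOneConnection o k p) {y : EuclideanSpace ℝ (Fin 4)}
    (hy : y ≠ p) (w : EuclideanSpace ℝ (Fin 4)) :
    clutchingFun o k p y * A.form 1 y w =
      A.form 0 y w * clutchingFun o k p y + fderiv ℝ (clutchingFun o k p) y w := by
  have hmem : y ∈ patch p 0 ∩ patch p 1 :=
    ⟨mem_patch_zero_iff.2 hy, by rw [patch_one_eq_univ]; exact mem_univ y⟩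
  have h := A.compat y hmem w
  rw [quatDeriv_eq_fderiv] at h
  have h0 : clutchingFun o k p y ≠ 0 := clutchingFun_ne_zero o hmem
  rw [h, mul_add, ← mul_assoc, ← mul_assoc, mul_inv_cancel₀ h0, one_mul, ← mul_assoc,
    mul_inv_cancel₀ h0, one_mul]
  rfl

/-- **Gauge covariance of the curvature on the overlap** (over flat `ℝ⁴`): for every connection
`A` on `P_k` and every `x ≠ p`, `γ(x) F₁(x)(u, v) = F₀(x)(u, v) γ(x)`, where `F_i = dA_i + A_i ∧ A_i`
are the patchwise curvatures and `γ` the clutching function — the transformation law of the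
curvature under the change of trivialisation `A₁ = γ⁻¹ A₀ γ + γ⁻¹ dγ` (Labastida–Mariño 2005,
§2.1, (2.3)–(2.4); Donaldson–Kronheimer 1990, §2.1). Proof: differentiate the gluing law
`γ A₁(v) = A₀(v) γ + ∂_v γ` in the direction `u`, antisymmetrise, and use the symmetry of the
second derivative of `γ`; the remaining first-order terms are `[A₀(u), A₀(v)] γ - γ [A₁(u), A₁(v)]`
by the gluing law again. [cite: LabastidaMarino2005, §2.1 (2.3)–(2.4)] -/
theorem clutchingFun_mul_curvature_one (A : SpOneConnection o k p) {x : EuclideanSpace ℝ (Fin 4)}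
    (hx : x ≠ p) (u v : EuclideanSpace ℝ (Fin 4)) :
    clutchingFun o k p x * A.curvature 1 x u v = A.curvature 0 x u v * clutchingFun o k p x := by
  set γ : EuclideanSpace ℝ (Fin 4) → ℍ := clutchingFun o k p with hγdef
  -- smoothness of the data at `x`
  have hγs : ContDiffAt ℝ ∞ γ x := contDiffAt_clutchingFun o k hx
  have hγd : DifferentiableAt ℝ γ x := hγs.differentiableAt (by simp)
  have hA0 := A.contDiffAt_form_zero hx
  have hA1 := A.contDiffAt_form_one x
  have hA0d := hA0.differentiableAt (by simp)
  have hA1d := hA1.differentiableAt (by simp)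
  have ha : ∀ w, DifferentiableAt ℝ (fun y ↦ A.form 1 y w) x := fun w ↦
    hA1d.clm_apply (differentiableAt_const w)
  have hb : ∀ w, DifferentiableAt ℝ (fun y ↦ A.form 0 y w) x := fun w ↦
    hA0d.clm_apply (differentiableAt_const w)
  have hγ' : ContDiffAt ℝ ∞ (fderiv ℝ γ) x := hγs.fderiv_right (by simp)
  have hγ'd : DifferentiableAt ℝ (fderiv ℝ γ) x := hγ'.differentiableAt (by simp)
  have h2 : minSmoothness ℝ 2 ≤ ∞ := by
    have h : ((2 : ℕ) : ℕ∞ω) ≤ ∞ := ENat.natCast_le_of_coe_top_le_withTop le_rfl 2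
    simpa using h
  -- the gluing law near `x`, and its derivative in the direction `z`
  have hev : ∀ w, (fun y ↦ A.form 0 y w * γ y + fderiv ℝ γ y w) =ᶠ[𝓝 x]
      (fun y ↦ γ y * A.form 1 y w) := fun w ↦ by
    filter_upwards [isOpen_compl_singleton.mem_nhds hx] with y hy
    exact (A.clutchingFun_mul_form_one hy w).symm
  have key : ∀ w z : EuclideanSpace ℝ (Fin 4),
      γ x * fderiv ℝ (fun y ↦ A.form 1 y w) x z =
        fderiv ℝ (fun y ↦ A.form 0 y w) x z * γ x + A.form 0 x w * fderiv ℝ γ x z +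
          fderiv ℝ (fderiv ℝ γ) x z w - fderiv ℝ γ x z * A.form 1 x w := by
    intro w z
    have hL : HasFDerivAt (fun y ↦ γ y * A.form 1 y w)
        (γ x • fderiv ℝ (fun y ↦ A.form 1 y w) x +
          MulOpposite.op (A.form 1 x w) • fderiv ℝ γ x) x :=
      hγd.hasFDerivAt.fun_mul' (ha w).hasFDerivAt
    have hR : HasFDerivAt (fun y ↦ A.form 0 y w * γ y + fderiv ℝ γ y w)
        (A.form 0 x w • fderiv ℝ γ x + MulOpposite.op (γ x) • fderiv ℝ (fun y ↦ A.form 0 y w) x +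
          ((fderiv ℝ γ x).comp (0 : EuclideanSpace ℝ (Fin 4) →L[ℝ] EuclideanSpace ℝ (Fin 4)) +
            (fderiv ℝ (fderiv ℝ γ) x).flip w)) x :=
      ((hb w).hasFDerivAt.fun_mul' hγd.hasFDerivAt).fun_add
        (hγ'd.hasFDerivAt.clm_apply (hasFDerivAt_const w x))
    have huniq := (hR.congr_of_eventuallyEq (hev w).symm).unique hL
    have hz := DFunLike.congr_fun huniq z
    simp only [_root_.add_apply, _root_.smul_apply, smul_eq_mul, op_smul_eq_mul,
      ContinuousLinearMap.comp_zero, zero_add, ContinuousLinearMap.flip_apply] at hz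
    rw [eq_sub_iff_add_eq, ← hz]
    abel
  -- symmetry of the second derivative of `γ`
  have hsym : fderiv ℝ (fderiv ℝ γ) x v u = fderiv ℝ (fderiv ℝ γ) x u v :=
    (hγs.isSymmSndFDerivAt h2) v u
  -- the gluing law at `x`
  have Cu : fderiv ℝ γ x u = γ x * A.form 1 x u - A.form 0 x u * γ x := by
    rw [A.clutchingFun_mul_form_one hx u]; abel
  have Cv : fderiv ℝ γ x v = γ x * A.form 1 x v - A.form 0 x v * γ x := by
    rw [A.clutchingFun_mul_form_one hx v]; abel
  -- the curvatures through `fderiv`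
  have hF1 : A.curvature 1 x u v =
      fderiv ℝ (fun y ↦ A.form 1 y v) x u - fderiv ℝ (fun y ↦ A.form 1 y u) x v +
        (A.form 1 x u * A.form 1 x v - A.form 1 x v * A.form 1 x u) := by
    rw [curvature, (A.form 1).extDeriv_eq_fderiv hA1d u v]
  have hF0 : A.curvature 0 x u v =
      fderiv ℝ (fun y ↦ A.form 0 y v) x u - fderiv ℝ (fun y ↦ A.form 0 y u) x v +
        (A.form 0 x u * A.form 0 x v - A.form 0 x v * A.form 0 x u) := by
    rw [curvature, (A.form 0).extDeriv_eq_fderiv hA0d u v]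
  rw [hF1, hF0, mul_add, mul_sub, key v u, key u v, hsym, Cu, Cv]
  noncomm_ring

/-- **`F₁ = γ⁻¹ F₀ γ` on the overlap** (over flat `ℝ⁴`), the conjugation form of
`clutchingFun_mul_curvature_one` (Labastida–Mariño 2005, §2.1; Donaldson–Kronheimer 1990, §2.1:
the curvature is a section of `Λ² ⊗ ad P`). [cite: LabastidaMarino2005, §2.1 (2.3)–(2.4)] -/
theorem curvature_one_eq_conj (A : SpOneConnection o k p) {x : EuclideanSpace ℝ (Fin 4)}
    (hx : x ≠ p) (u v : EuclideanSpace ℝ (Fin 4)) :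
    A.curvature 1 x u v =
      (clutchingFun o k p x)⁻¹ * A.curvature 0 x u v * clutchingFun o k p x := by
  have h0 : clutchingFun o k p x ≠ 0 :=
    clutchingFun_ne_zero o ⟨mem_patch_zero_iff.2 hx, by rw [patch_one_eq_univ]; exact mem_univ x⟩
  rw [mul_assoc, eq_inv_mul_iff_mul_eq₀ h0]
  exact A.clutchingFun_mul_curvature_one hx u v

/-- Conjugation by a non-zero quaternion preserves the norm `|ξ|² = 2‖ξ‖²`. [folklore] -/
theorem adNormSq_conj {γ : ℍ} (hγ : γ ≠ 0) (ξ : ℍ) : adNormSq (γ⁻¹ * ξ * γ) = adNormSq ξ := by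
  have hn : ‖γ‖ ≠ 0 := norm_ne_zero_iff.2 hγ
  simp only [adNormSq, norm_mul, norm_inv]
  field_simp

/-- **The pointwise norm of the curvature may be read through either patch** (over flat `ℝ⁴`):
`|F₁|²_g(x) = |F₀|²_g(x)` for `x ≠ p`, for any metric `g` (`F₁ = γ⁻¹ F₀ γ` and `|·|` is
conjugation invariant; Donaldson–Kronheimer 1990, §2.1). [cite: DonaldsonKronheimer1990, §2.1] -/
theorem twoFormNormSq_curvature_one (A : SpOneConnection o k p)
    (g : PseudoRiemannianMetric (𝓡 4) ∞ (EuclideanSpace ℝ (Fin 4))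
      (TangentSpace (𝓡 4) : EuclideanSpace ℝ (Fin 4) → Type _))
    {x : EuclideanSpace ℝ (Fin 4)} (hx : x ≠ p) :
    twoFormNormSq g x (A.curvature 1 x) = twoFormNormSq g x (A.curvature 0 x) := by
  have h0 : clutchingFun o k p x ≠ 0 :=
    clutchingFun_ne_zero o ⟨mem_patch_zero_iff.2 hx, by rw [patch_one_eq_univ]; exact mem_univ x⟩
  by_cases h : ∃ e : Fin 4 → TangentSpace (𝓡 4) x, g.IsOrthonormalFrame x e
  · obtain ⟨e, he⟩ := h
    rw [twoFormNormSq_eq_six_of_isOrthonormalFrame g (A.curvature_add_left 1 x)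
        (A.curvature_smul_left 1 x) (fun u v ↦ A.curvature_swap 1 x v u) he,
      twoFormNormSq_eq_six_of_isOrthonormalFrame g (A.curvature_add_left 0 x)
        (A.curvature_smul_left 0 x) (fun u v ↦ A.curvature_swap 0 x v u) he]
    simp only [A.curvature_one_eq_conj hx, adNormSq_conj h0]
  · rw [twoFormNormSq_of_not_exists g _ h, twoFormNormSq_of_not_exists g _ h]

/-- **The curvature density through any patch containing the point** (over flat `ℝ⁴`):
`ρ_A(x) = |F_i|²_g(x)` whenever `x ∈ patch p i`, not only for the patch `patchIndex p x` used in
the definition. [cite: DonaldsonKronheimer1990, §2.1] -/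
theorem curvatureDensity_eq_twoFormNormSq (A : SpOneConnection o k p)
    (g : PseudoRiemannianMetric (𝓡 4) ∞ (EuclideanSpace ℝ (Fin 4))
      (TangentSpace (𝓡 4) : EuclideanSpace ℝ (Fin 4) → Type _))
    {i : Fin 2} {x : EuclideanSpace ℝ (Fin 4)} (hx : x ∈ patch p i) :
    A.curvatureDensity g x = twoFormNormSq g x (A.curvature i x) := by
  unfold curvatureDensity patchIndex
  split_ifs with hxp
  · subst hxp
    fin_cases i
    · simp at hx
    · rfl
  · fin_cases i
    · rfl
    · exact (A.twoFormNormSq_curvature_one g hxp).symm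

/-- Conjugation commutes with sums and detects zero: `γ⁻¹ a γ + γ⁻¹ b γ = 0 ↔ a + b = 0`.
[folklore] -/
theorem conj_add_conj_eq_zero_iff {γ : ℍ} (hγ : γ ≠ 0) (a b : ℍ) :
    γ⁻¹ * a * γ + γ⁻¹ * b * γ = 0 ↔ a + b = 0 := by
  rw [← add_mul, ← mul_add, mul_eq_zero, mul_eq_zero, inv_eq_zero, or_iff_left hγ,
    or_iff_right hγ]

/-- **Anti-self-duality may be read through either patch** (over flat `ℝ⁴`): for `x ≠ p` and any
frame `e`, `F₁(x)` is anti-self-dual in `e` iff `F₀(x)` is (`F₁ = γ⁻¹ F₀ γ` and conjugation is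
linear and injective; Labastida–Mariño 2005, (2.17), (2.19): the condition is gauge invariant).
[cite: LabastidaMarino2005, (2.17), (2.19)] -/
theorem isASDIn_curvature_one_iff (A : SpOneConnection o k p) {x : EuclideanSpace ℝ (Fin 4)}
    (hx : x ≠ p) (e : Fin 4 → TangentSpace (𝓡 4) x) :
    IsASDIn (A.curvature 1 x) e ↔ IsASDIn (A.curvature 0 x) e := by
  have h0 : clutchingFun o k p x ≠ 0 :=
    clutchingFun_ne_zero o ⟨mem_patch_zero_iff.2 hx, by rw [patch_one_eq_univ]; exact mem_univ x⟩
  unfold IsASDIn sdComponents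
  simp only [A.curvature_one_eq_conj hx]
  constructor
  · intro h
    have c0 := (conj_add_conj_eq_zero_iff h0 _ _).1 (congr_fun h 0)
    have c1 := (conj_add_conj_eq_zero_iff h0 _ _).1 (congr_fun h 1)
    have c2 := (conj_add_conj_eq_zero_iff h0 _ _).1 (congr_fun h 2)
    funext i
    fin_cases i
    · exact c0
    · exact c1
    · exact c2
  · intro h
    have c0 := (conj_add_conj_eq_zero_iff h0 _ _).2 (congr_fun h 0)
    have c1 := (conj_add_conj_eq_zero_iff h0 _ _).2 (congr_fun h 1)
    have c2 := (conj_add_conj_eq_zero_iff h0 _ _).2 (congr_fun h 2)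
    funext i
    fin_cases i
    · exact c0
    · exact c1
    · exact c2

/-- **Over flat `ℝ⁴`, anti-self-duality is a condition on the ball-patch form alone**: a
connection on `P_k` is `g`-anti-self-dual iff `F₁⁺ = 0` at every point, in every positively
oriented `g`-orthonormal frame (the ball patch is all of `ℝ⁴`, and on the punctured patch
`F₀ = γ F₁ γ⁻¹` is anti-self-dual with `F₁`). [cite: LabastidaMarino2005, (2.17), (2.19)] -/
theorem isASD_iff_patch_one (A : SpOneConnection o k p)
    (g : PseudoRiemannianMetric (𝓡 4) ∞ (EuclideanSpace ℝ (Fin 4))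
      (TangentSpace (𝓡 4) : EuclideanSpace ℝ (Fin 4) → Type _)) :
    A.IsASD g ↔ ∀ (x : EuclideanSpace ℝ (Fin 4)) (e : Fin 4 → TangentSpace (𝓡 4) x),
      IsPosOrthonormalFrame g o x e → IsASDIn (A.curvature 1 x) e := by
  constructor
  · intro h x e he
    exact h 1 x (by rw [patch_one_eq_univ]; exact mem_univ x) e he
  · intro h i x hx e he
    fin_cases i
    · exact (A.isASDIn_curvature_one_iff (mem_patch_zero_iff.1 hx) e).1 (h x e he)
    · exact h x e he

end SpOneConnection

end Literature.Geometry.GaugeTheory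

end
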